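import Mathlib.Data.ENat.Lattice
import Summits.BirchSwinnertonDyer.BirchSwinnertonDyer.Theorems.ClassRecordThreeEulerHalvesAtThreeSection6Joined
import HarnessLib

/-!
# Kolyvagin's redefinition of `m_∞` from the prime swap and the hypothesis-`hfin`-free END of Jetchev's walk,
# over ABSTRACT conductor data (cell `bsd-stepL`, seat `bsd-stepL-corner3-p2` g7 = WIDTH-LEVER lane B;
# `--supports stmt-BirchSwinnertonDyer-21420 --as helper`)

WHY. The corner line `Cruxes/CornerAtThreeW/Lines/inert.lean` r5 (crux 21420 `CornerAtThreeW`) and crux 19109's line r3∕r4 consume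
ONE typed classical-Kolyvagin-grade input, the (DIV) conjunct of `ShimuraKolyvaginOfImage.primitivesDivAtThreeInert` (p588795) =
Jetchev 2008 Thm. 1.4 READ on the Shimura curve `X_{N⁺,N⁻}` for the LABELLED CM family `ys : (m : ℕ) → E(K[m])` (Kim 2022 Rem. 7.9
asserts it; not in print). The tree proves Thm. 1.4 for `X₀(N)` Heegner data `d : KolyvaginHeegnerData Dt β ι n` in three layers:
(i) bsd-jet's CARRIER-BLIND §6 over abstract conductors `Λ` (`JET.Section6.tamagawaExponent_le_mInfty_of_coreVertices`,
`…_of_perLevel`, `depth_le_mdiv_of_perLevel`, `exists_halfCoreVertex`; and `Koly.exists_deep_conductor_of_swap` for McCallum's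
Prop. 5.2), (ii) Kolyvagin's REDEFINITION of `m_∞` from the swap — `Koly.kolyvaginRedefinition_of_swap` (corner-p1 g8, p507157) —
which is the ONLY piece of the top layer written on the concrete index `(n, d : KolyvaginHeegnerData …)`, and (iii) the
instantiation layer (concrete Selmer structures, classes, Prop. 4.7∕4.9, Lemma 6.1; ≈ 160 datum-dependent files). A port of the walk to
the labelled Shimura family (PORT-SPEC (P1)+(P2), HOME/corner3/g6∕g7) indexes conductors by (level, presentation of Kolyvagin's
operator), not by `d`; THIS FILE supplies layer (ii) for ANY index type, so that the port's top layer is pure instantiation: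
* `exists_mInfty_of_swap` — McCallum 1991 Lemma 5.1 + Prop. 5.2 (`C = {0}`) as order theory: from ONE conductor with
  `m'(c) < M(c)` (`hfin`) and the swap supply (`hswap`: «all conductors over index `≥ μ + 1` are `p^μ`-divisible and `c` over index
  `≥ μ + 1` is not `p^{μ+1}`-divisible ⟹ some conductor over index `≥ e` is not `p^{μ+1}`-divisible», the conclusion of
  `Koly.exists_deep_conductor_of_swap`), an `m_∞ : ℕ` with `m_∞ ≤ m(c)` everywhere and ATTAINED over arbitrarily deep conductors
  — the hypotheses `hmInf`, `hK` of `JET.Section6.depth_le_mdiv_of_perLevel` ∕ `…_of_coreVertices`;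
* `depth_le_mdiv_of_swap_of_perLevel` — the `hfin`-free END: swap supply + per-level inequality ⟹ `s ≤ m'(c)` for every `s ≤ t`
  and every conductor of index `≥ s` (if no conductor has `m'(c) < M(c)` the conclusion is immediate; else the two theorems above);
  the abstract twin of corner-p1's `Koly.pDiv_of_swap_of_perLevel` (p514959).
Dictionary: `Λ` = conductors (classically pairs `(n, d)`; for the labelled family pairs (square-free level on Kolyvagin primes,
presentation `(σ', H', f')`)); `M c : ℕ∞` = the level index `min_{ℓ ∣ c} M(ℓ)` (`⊤` at level `1`); `mdiv c : ℕ∞` = `m'(c)`, the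
exact `p`-divisibility exponent of the derived point `P_c` in `E(K[c])` (`⊤` if infinitely divisible, e.g. torsion of order prime to
`p`), so «`p^μ ∣ P_c`» reads `(μ : ℕ∞) ≤ mdiv c`; `m c := if mdiv c < M c then mdiv c else ⊤` ([J] §3.1 item 5 ∕ McCallum p. 303).
HONEST FRAMING: pure order theory over abstract data; THEOREMS ONLY (no definition, no named fact, no `sorry`); nothing about any
curve; no stub of any line is discharged; the (DIV) input stays OPEN; BSD is not proved by any of this; T7.
References (locators only): [cite: McCallumLMS1991, §5 Lemma 5.1 and Prop. 5.2 (pp. 303–306)] [cite: Jetchev2008, Thm. 1.4 (p. 812),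
§3.1 item 5 (p. 817), proof of Thm. 1.1 (p. 824)] [cite: BurungaleEtAl2026, Prop. 2.2.1 (§2.2)]. Credit: corner-p1 g8 (the concrete
proof followed here line by line), bsd-jet pv-2 (the abstract §6), tam3-p1 (the per-level deduction).
Axioms: `propext`, `Classical.choice`, `Quot.sound`.
-/

set_option autoImplicit false

noncomputable section

open scoped Classical

namespace Summit.BirchSwinnertonDyer.Rank1Residual.JET.Section6

/-- **Kolyvagin's redefinition of `m_∞` from the prime swap, abstract** (McCallum 1991 Lemma 5.1 + Prop. 5.2 with `C = {0}`;
the abstract twin of `Koly.kolyvaginRedefinition_of_swap`). Data: conductors `Λ`, level index `M`, divisibility exponent `mdiv`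
(dictionary in the module docstring). `hfin`: some conductor has `m'(c) < M(c)`. `hswap`: for all `μ e`, if every conductor of
index `≥ μ + 1` is `p^μ`-divisible and `c` (index `≥ μ + 1`) is not `p^{μ+1}`-divisible, some conductor of index `≥ e` is not
`p^{μ+1}`-divisible. CONCLUSION: an `m_∞ : ℕ` with `m_∞ ≤ m(c)` for every `c` and, for every `m'`, a conductor `c` with
`m' ≤ M(c)` and `m(c) = m_∞`. Pure order theory; nothing booked.
[cite: McCallumLMS1991, §5 Lemma 5.1, Prop. 5.2 (pp. 303–306)] [cite: Jetchev2008, proof of Thm. 1.1 (p. 824)] -/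
theorem exists_mInfty_of_swap {Λ : Type*} (M mdiv : Λ → ℕ∞)
    (hfin : ∃ c, mdiv c < M c)
    (hswap : ∀ (μ e : ℕ) (c : Λ), ((μ + 1 : ℕ) : ℕ∞) ≤ M c →
      (∀ c', ((μ + 1 : ℕ) : ℕ∞) ≤ M c' → (μ : ℕ∞) ≤ mdiv c') →
      ¬ ((μ + 1 : ℕ) : ℕ∞) ≤ mdiv c →
      ∃ c', (e : ℕ∞) ≤ M c' ∧ ¬ ((μ + 1 : ℕ) : ℕ∞) ≤ mdiv c') :
    ∃ mInf : ℕ,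
      (∀ c, (mInf : ℕ∞) ≤ (if mdiv c < M c then mdiv c else ⊤)) ∧
      (∀ m' : ℕ, ∃ c, (m' : ℕ∞) ≤ M c ∧ (if mdiv c < M c then mdiv c else (⊤ : ℕ∞)) = mInf) := by
  -- the set of FINITE values `m'(c) < M(c)`
  let S : Set ℕ := {u | ∃ c, mdiv c = (u : ℕ∞) ∧ (u : ℕ∞) < M c}
  have hmemS : ∀ c, mdiv c < M c → (mdiv c).toNat ∈ S ∧ mdiv c = ((mdiv c).toNat : ℕ∞) := by
    intro c hlt
    have hne : mdiv c ≠ ⊤ := ne_top_of_lt hlt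
    have heq : mdiv c = ((mdiv c).toNat : ℕ∞) := (ENat.coe_toNat hne).symm
    exact ⟨⟨c, heq, heq ▸ hlt⟩, heq⟩
  obtain ⟨c₀, hlt₀⟩ := hfin
  have hS : S.Nonempty := ⟨_, (hmemS c₀ hlt₀).1⟩
  -- `m_∞ := min S`
  set mInf : ℕ := sInf S with hmInf_def
  have hmem : mInf ∈ S := Nat.sInf_mem hS
  have hle : ∀ u ∈ S, mInf ≤ u := fun u hu => Nat.sInf_le hu
  -- clause 1
  have hclause1 : ∀ c, (mInf : ℕ∞) ≤ (if mdiv c < M c then mdiv c else ⊤) := by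
    intro c
    by_cases h : mdiv c < M c
    · rw [if_pos h]
      obtain ⟨hu, heq⟩ := hmemS c h
      rw [heq]
      exact_mod_cast hle _ hu
    · rw [if_neg h]; exact le_top
  -- minimality: over index `≥ m_∞ + 1`, every `P_{c'}` is `p^{m_∞}`-divisible
  have hall : ∀ c', ((mInf + 1 : ℕ) : ℕ∞) ≤ M c' → (mInf : ℕ∞) ≤ mdiv c' := by
    intro c' hidx
    by_cases h : mdiv c' < M c'
    · obtain ⟨hu, heq⟩ := hmemS c' h
      rw [heq]
      exact_mod_cast hle _ hu
    · calc (mInf : ℕ∞) ≤ ((mInf + 1 : ℕ) : ℕ∞) := by exact_mod_cast Nat.le_succ mInf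
        _ ≤ M c' := hidx
        _ ≤ mdiv c' := not_lt.mp h
  refine ⟨mInf, hclause1, fun m' => ?_⟩
  -- clause 2: a conductor attaining `m_∞`, then the swap at depth `max m' (m_∞ + 2)`
  obtain ⟨c₁, hdiv₁, hlt₁⟩ := hmem
  have hidx₁ : ((mInf + 1 : ℕ) : ℕ∞) ≤ M c₁ := by
    have := Order.add_one_le_of_lt hlt₁
    exact_mod_cast this
  have hnot₁ : ¬ ((mInf + 1 : ℕ) : ℕ∞) ≤ mdiv c₁ := by
    intro h
    rw [hdiv₁] at h
    have : mInf + 1 ≤ mInf := by exact_mod_cast h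
    omega
  obtain ⟨c', hM', hnot'⟩ := hswap mInf (max m' (mInf + 2)) c₁ hidx₁ hall hnot₁
  -- `m'(c') = m_∞`
  have hge' : (mInf : ℕ∞) ≤ mdiv c' :=
    hall c' (le_trans (by exact_mod_cast (by omega : mInf + 1 ≤ max m' (mInf + 2))) hM')
  have hne' : mdiv c' ≠ ⊤ := by
    intro h
    exact hnot' (h ▸ le_top)
  have hdiv' : mdiv c' = (mInf : ℕ∞) := by
    apply le_antisymm _ hge'
    have heq : mdiv c' = ((mdiv c').toNat : ℕ∞) := (ENat.coe_toNat hne').symm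
    rw [heq] at hnot' ⊢
    have : ¬ mInf + 1 ≤ (mdiv c').toNat := fun h => hnot' (by exact_mod_cast h)
    exact_mod_cast (by omega : (mdiv c').toNat ≤ mInf)
  have hlt' : mdiv c' < M c' := by
    rw [hdiv']
    calc (mInf : ℕ∞) < ((max m' (mInf + 2) : ℕ) : ℕ∞) := by
          exact_mod_cast (by omega : mInf < max m' (mInf + 2))
      _ ≤ M c' := hM'
  refine ⟨c', le_trans (by exact_mod_cast le_max_left m' (mInf + 2)) hM', ?_⟩
  rw [if_pos hlt', hdiv']

/-- **The `hfin`-free END of the walk, abstract** (twin of corner-p1's `Koly.pDiv_of_swap_of_perLevel`): the swap supply `hswap`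
(as above) and the per-level inequality `hlev` («`m(c) < k`, `t ≤ k`, `k + m(c) ≤ M(c)` ⟹ `t ≤ m(c)`», the output of Jetchev's
§6 = `tamagawaExponent_le_m_of_selmerFamilies` per conductor) give, for every `s ≤ t` and every conductor `c` with `s ≤ M(c)`,
`s ≤ m'(c)` — i.e. `p^s ∣ P_c`. If no conductor has `m'(c) < M(c)` this is immediate (`s ≤ M(c) ≤ m'(c)`); otherwise
`exists_mInfty_of_swap` feeds `depth_le_mdiv_of_perLevel`. Pure order theory; CONDITIONAL on the displayed hypotheses; nothing booked.
[cite: Jetchev2008, Thm. 1.4 (p. 812), proof of Thm. 1.1 (p. 824)] [cite: McCallumLMS1991, §5 Prop. 5.2 (p. 304)] -/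
theorem depth_le_mdiv_of_swap_of_perLevel {Λ : Type*} (M mdiv : Λ → ℕ∞) (t : ℕ)
    (hswap : ∀ (μ e : ℕ) (c : Λ), ((μ + 1 : ℕ) : ℕ∞) ≤ M c →
      (∀ c', ((μ + 1 : ℕ) : ℕ∞) ≤ M c' → (μ : ℕ∞) ≤ mdiv c') →
      ¬ ((μ + 1 : ℕ) : ℕ∞) ≤ mdiv c →
      ∃ c', (e : ℕ∞) ≤ M c' ∧ ¬ ((μ + 1 : ℕ) : ℕ∞) ≤ mdiv c')
    (hlev : ∀ (k : ℕ) (c : Λ), (if mdiv c < M c then mdiv c else (⊤ : ℕ∞)) < (k : ℕ∞) → t ≤ k →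
      (k : ℕ∞) + (if mdiv c < M c then mdiv c else ⊤) ≤ M c →
      (t : ℕ∞) ≤ (if mdiv c < M c then mdiv c else ⊤))
    (s : ℕ) (hs : s ≤ t) (c : Λ) (hsc : (s : ℕ∞) ≤ M c) :
    (s : ℕ∞) ≤ mdiv c := by
  by_cases hfin : ∃ c, mdiv c < M c
  · obtain ⟨mInf, hmInf, hK⟩ := exists_mInfty_of_swap M mdiv hfin hswap
    exact depth_le_mdiv_of_perLevel M mdiv (fun c => if mdiv c < M c then mdiv c else ⊤)
      (fun c h => by simp [h]) t mInf hmInf hK hlev s hs c hsc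
  · push Not at hfin
    exact hsc.trans (hfin c)

end Summit.BirchSwinnertonDyer.Rank1Residual.JET.Section6

end
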